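import Summits.QuantumFields.BalabanUV.T4Continuum.Support.GradedWellData
import Summits.QuantumFields.BalabanUV.T4Continuum.Support.GradedSubBlocksPoincare

/-!
# T⁴ programme, spine node NE2 (U1a), sub-row Δ1 — THE GRADED WELL, file 6: SOCKET (GW-S0) DISCHARGED — the graded scalar operator
# `Δ′_GW = −Δ + a′·Q′_GWwᴴQ′_GWw` is COERCIVE with a LEVEL-FREE constant `gamGW d m a′ = min(1/(8d(m+1)+1), a′/2)`, hence invertible
# with `‖G′_GW‖ ≤ gamGW⁻¹` and `0 < ‖Δ′_GW‖` (the hypotheses `hD`, `hD0`, `hg` of `GradedWellSlice.coercive_regionGW_of_slice`)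

Row NE2 OWNER (unit `b2b-balaban-t4-ne2-p1`, gen 16), item O16-e of RULING R47, on files 1c (`GradedSubBlocksPoincare`: the sub-block
Poincaré inequality at every scale `s ≤ n`) and 2 (`GradedWellData`).  Argument (the graded version of leaf-09's `ScalarAveragedPropagator`
coercivity): partition the sites by the layer of their unit block (`layer ≤ m`); on layer `i` compare `ψ` with its scale-`s_i` block means:
`|ψ|² ≤ 2|ψ − Π_{s_i}ψ|² + 2|Π_{s_i}ψ|²`; the first sums (over ALL scales) to `≤ 2(m+1)·4d·Σ_ν‖∂_νψ‖²` by file 1c, the second is EXACTLY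
`2·Σ_{rows}s_i^d|Q′_{s_i}ψ|² ≤ 2·‖Q′_GWwψ‖²` (weights `w_i² = L^{2i}s_i^d ≥ s_i^d`); and `Re⟨ψ, Δ′_GWψ⟩ = Σ_ν‖∂_νψ‖² + a′‖Q′_GWwψ‖²`.

 * §1 bookkeeping: `sGW_le` (`s_i ≤ n`), `lidx` (the layer index of a site as an element of `Fin (m+1)`), `sum_sites_by_layer`,
   `sum_layer_PiSc_sq` (`Σ_{x ∈ layer i}|Π_{s_i}ψ(x)|² = Σ_{(i,z) ∈ RowS}s_i^d|Q′_{s_i}ψ(z)|²`), `nsq_QsGWw_eq`, `form_DpGW`;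
 * §2 **`nsq_le_graded`**: `nsq ψ ≤ 8d(m+1)·Σ_ν nsq (∂_νψ) + 2·nsq (Q′_GWwψ)`; **`coercive_DpGW (hlay) (ha′ : 0 < a′) : Coercive (DpGW …) (gamGW d m a′)`**,
   `isUnit_det_DpGW`, **`opNorm_GOmGW_le : ‖GOmGW‖ ≤ (gamGW d m a′)⁻¹`**, `opNorm_DpGW_pos`.

HONEST FRAMING (T4-DAG p. 1).  [folklore] lattice calculus at model level (`U = 1`, one layer map on unit blocks, `m` fixed, finite torus); constants
ours (`m`-dependent, level-FREE); nothing printed is a hypothesis; NE2 (U1a) NOT proved; spine PROVED 0/9 unchanged; NOT [B9] (3.16)/(3.23)–(3.27)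
as printed; NOT infinite volume / mass gap / Clay.  HONEST DEPENDENCY: continuum YM on T⁴ ⇐ BetaPertH ∧ nine spine estimates (0/9 proved);
BetaPertH ⇐ (D1) ∧ (D4) ∧ CAP+tail; G-an2-4 gates asym, D1 and NE2/3/4.  No `sorry`.
-/

noncomputable section

open scoped BigOperators ComplexConjugate Matrix Matrix.Norms.L2Operator
open Finset

namespace Summit.QuantumFields.BalabanUV.T4Continuum.GradedWellScalarCoercive

open Literature.MathematicalPhysics.QuantumFieldTheory.Balaban1983to89.B5Prop11Plancherel (Tor fine)
open Literature.MathematicalPhysics.QuantumFieldTheory.Balaban1983to89.B5Prop11Lower (nsq nsq_nonneg star_dotProduct_self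
  norm_star_dotProduct_le)
open Literature.MathematicalPhysics.QuantumFieldTheory.Balaban1983to89.B5Blocks16 (blockOf)
open Literature.MathematicalPhysics.QuantumFieldTheory.Balaban1983to89.B5Action121 (sdiff LapS)
open Literature.MathematicalPhysics.QuantumFieldTheory.Balaban1983to89.B5G183RateUnitTower (lev lev_neZero)
open Summit.QuantumFields.BalabanUV.T4Continuum
open Summit.QuantumFields.BalabanUV.T4Continuum.SubtypeCompression (Coercive isUnit_det_of_coercive opNorm_inv_le_of_coercive)
open Summit.QuantumFields.BalabanUV.T4Continuum.ScalarBlockPoincare (nsq_add_le form_LapS_eq)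
open Summit.QuantumFields.BalabanUV.T4Continuum.RegionGaugeSlice (form_gram)
open Summit.QuantumFields.BalabanUV.T4Continuum.GradedSubBlocks (Anchor Anc InSub site meanS s_pos inSub_site)
open Summit.QuantumFields.BalabanUV.T4Continuum.GradedSubBlocksRefine (blockOf_eq_of_inSub)
open Summit.QuantumFields.BalabanUV.T4Continuum.GradedSubBlocksPoincare (PiSc PiSc_apply_site sum_sites_eq nsq_sub_PiSc_le card_offsets)
open Summit.QuantumFields.BalabanUV.T4Continuum.GradedWellData

variable {d : ℕ} (L : ℕ) [NeZero L] (M : Fin d → ℕ) [hM : ∀ μ, NeZero (M μ)] (k m : ℕ) (layer : Tor M → ℕ) (a' : ℝ)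

/-! ## §1 Bookkeeping -/

omit hM in
/-- `s_i ≤ n`: every scale is at most the number of fine sites per unit block (`L ≥ 1`). [folklore] -/
theorem sGW_le (i : ℕ) : sGW L k i ≤ lev L k := by
  show lev L (k - i) ≤ lev L k
  rw [lev_eq_pow, lev_eq_pow]
  exact Nat.pow_le_pow_right (Nat.pos_of_ne_zero (NeZero.ne L)) (Nat.sub_le k i)

omit [NeZero L] hM in
/-- `s_i ∣ n`. [folklore] -/
theorem sGW_dvd_lev' (i : ℕ) : sGW L k i ∣ lev L k := by
  show lev L (k - i) ∣ lev L k
  rw [lev_eq_pow, lev_eq_pow]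
  exact Nat.pow_dvd_pow L (Nat.sub_le k i)

/-- the layer of (the unit block of) a site, as an element of `Fin (m+1)` (given `layer ≤ m`). [folklore] -/
def lidx (hlay : ∀ y, layer y ≤ m) (x : TorK L M k) : Fin (m + 1) :=
  ⟨layer (blockOf (lev L k) M x), Nat.lt_succ_of_le (hlay _)⟩

/-- partition of a sum over sites by layer. [folklore] -/
theorem sum_sites_by_layer (hlay : ∀ y, layer y ≤ m) (g : TorK L M k → ℝ) :
    ∑ x, g x = ∑ i : Fin (m + 1), ∑ x, (if lidx L M k m layer hlay x = i then g x else 0) := by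
  rw [Finset.sum_comm]
  refine Finset.sum_congr rfl fun x _ => ?_
  rw [Finset.sum_ite_eq]
  simp

/-- on layer `i`, the squares of the scale-`s_i` block means sum to `Σ_{z : layer-i anchors} s_i^d·|Q′_{s_i}ψ(z)|²`. [folklore] -/
theorem sum_layer_PiSc_sq (hlay : ∀ y, layer y ≤ m) (i : Fin (m + 1)) (ψ : TorK L M k → ℂ) :
    ∑ x, (if lidx L M k m layer hlay x = i then ‖(PiSc (fine (lev L k) M) (sGW L k i) *ᵥ ψ) x‖ ^ 2 else 0)
      = ∑ z : Anc (fine (lev L k) M) (sGW L k i),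
          (if layer (blockOf (lev L k) M z.1) = i then ((sGW L k i : ℕ) : ℝ) ^ d * ‖(meanS (fine (lev L k) M) (sGW L k i) *ᵥ ψ) z‖ ^ 2
           else 0) := by
  rw [sum_sites_eq (fine (lev L k) M) (sGW L k i) (sGW_dvd L M k i)]
  refine Finset.sum_congr rfl fun z _ => ?_
  have hb : ∀ j : Fin d → Fin (sGW L k i), blockOf (lev L k) M (site (fine (lev L k) M) (sGW L k i) z.1 j) = blockOf (lev L k) M z.1 :=
    fun j => blockOf_eq_of_inSub (lev L k) M (sGW L k i) (sGW_dvd_lev' L k i) (inSub_site (fine (lev L k) M) (sGW L k i) (sGW_dvd L M k i) z.2 j)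
  have hl : ∀ j : Fin d → Fin (sGW L k i), (lidx L M k m layer hlay (site (fine (lev L k) M) (sGW L k i) z.1 j) = i)
      ↔ layer (blockOf (lev L k) M z.1) = i := fun j => by
    rw [Fin.ext_iff]; simp only [lidx, hb j]
  simp_rw [hl, PiSc_apply_site (fine (lev L k) M) (sGW L k i) (sGW_dvd L M k i)]
  split_ifs
  · rw [Finset.sum_const, Finset.card_univ, nsmul_eq_mul, card_offsets]
  · simp

/-- `nsq (Q′_GWwψ) = Σ_i Σ_{z : layer-i anchors} w_i²·|Q′_{s_i}ψ(z)|²`. [folklore] -/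
theorem nsq_QsGWw_eq (ψ : TorK L M k → ℂ) :
    nsq (QsGWw L M k m layer *ᵥ ψ)
      = ∑ i : Fin (m + 1), ∑ z : Anc (fine (lev L k) M) (sGW L k i),
          (if layer (blockOf (lev L k) M z.1) = i then wGW L k d i ^ 2 * ‖(meanS (fine (lev L k) M) (sGW L k i) *ᵥ ψ) z‖ ^ 2 else 0) := by
  have e1 : ∀ p : RowS L M k m layer, ‖(QsGWw L M k m layer *ᵥ ψ) p‖ ^ 2
      = wGW L k d p.1.1 ^ 2 * ‖(meanS (fine (lev L k) M) (sGW L k p.1.1) *ᵥ ψ) p.1.2‖ ^ 2 := by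
    intro p
    have e : (QsGWw L M k m layer *ᵥ ψ) p = ((wGW L k d p.1.1 : ℝ) : ℂ) * (meanS (fine (lev L k) M) (sGW L k p.1.1) *ᵥ ψ) p.1.2 := by
      simp only [Matrix.mulVec, dotProduct, QsGWw, QsGW, mul_assoc, ← Finset.mul_sum]
    rw [e, norm_mul, mul_pow, Complex.norm_real, Real.norm_of_nonneg (wGW_nonneg L k d p.1.1)]
  unfold nsq
  rw [Finset.sum_congr rfl fun p _ => e1 p]
  let P : ((i : Fin (m + 1)) × Anc (fine (lev L k) M) (sGW L k i)) → Prop := fun q => layer (blockOf (lev L k) M q.2.1) = q.1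
  let F : ((i : Fin (m + 1)) × Anc (fine (lev L k) M) (sGW L k i)) → ℝ :=
    fun q => wGW L k d q.1 ^ 2 * ‖(meanS (fine (lev L k) M) (sGW L k q.1) *ᵥ ψ) q.2‖ ^ 2
  have key : ∑ q ∈ Finset.univ.filter P, F q = ∑ p : RowS L M k m layer, F p.1 :=
    Finset.sum_subtype (Finset.univ.filter P) (by intro x; simp [P]) F
  show ∑ p : RowS L M k m layer, F p.1 = ∑ i, ∑ z, if P ⟨i, z⟩ then F ⟨i, z⟩ else 0
  rw [← key, Finset.sum_filter, Fintype.sum_sigma]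

/-- `Re⟨ψ, Δ′_GWψ⟩ = Σ_ν nsq (∂_νψ) + a′·nsq (Q′_GWwψ)`. [folklore] -/
theorem form_DpGW (ψ : TorK L M k → ℂ) :
    (star ψ ⬝ᵥ (DpGW L M k m layer a' *ᵥ ψ)).re
      = (∑ ν, nsq (sdiff (fine (lev L k) M) ((lev L k : ℕ) : ℂ) ν *ᵥ ψ)) + a' * nsq (QsGWw L M k m layer *ᵥ ψ) := by
  unfold DpGW
  rw [Matrix.add_mulVec, dotProduct_add, Complex.add_re, form_LapS_eq, Complex.ofReal_re, Matrix.smul_mulVec, dotProduct_smul,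
    form_gram, smul_eq_mul, ← Complex.ofReal_mul, Complex.ofReal_re]

/-! ## §2 The graded Poincaré bound and coercivity -/

/-- **THE GRADED POINCARÉ BOUND**: `nsq ψ ≤ 8d(m+1)·Σ_ν nsq (∂_νψ) + 2·nsq (Q′_GWwψ)` (given `layer ≤ m`). [folklore] -/
theorem nsq_le_graded (hlay : ∀ y, layer y ≤ m) (ψ : TorK L M k → ℂ) :
    nsq ψ ≤ 8 * d * (m + 1) * (∑ ν, nsq (sdiff (fine (lev L k) M) ((lev L k : ℕ) : ℂ) ν *ᵥ ψ)) + 2 * nsq (QsGWw L M k m layer *ᵥ ψ) := by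
  set D : ℝ := ∑ ν, nsq (sdiff (fine (lev L k) M) ((lev L k : ℕ) : ℂ) ν *ᵥ ψ) with hD
  have hD0 : 0 ≤ D := Finset.sum_nonneg fun ν _ => nsq_nonneg _
  have hL1 : (1 : ℝ) ≤ L := by exact_mod_cast Nat.pos_of_ne_zero (NeZero.ne L)
  -- per layer
  have key : ∀ i : Fin (m + 1), ∑ x, (if lidx L M k m layer hlay x = i then ‖ψ x‖ ^ 2 else 0)
      ≤ 2 * (4 * d * D) + 2 * ∑ z : Anc (fine (lev L k) M) (sGW L k i),
          (if layer (blockOf (lev L k) M z.1) = i then wGW L k d i ^ 2 * ‖(meanS (fine (lev L k) M) (sGW L k i) *ᵥ ψ) z‖ ^ 2 else 0) := by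
    intro i
    set P := PiSc (fine (lev L k) M) (sGW L k i) *ᵥ ψ with hP
    have h1 : ∀ x, (if lidx L M k m layer hlay x = i then ‖ψ x‖ ^ 2 else 0)
        ≤ 2 * ‖(ψ - P) x‖ ^ 2 + (if lidx L M k m layer hlay x = i then 2 * ‖P x‖ ^ 2 else 0) := by
      intro x
      have hx : ‖ψ x‖ ^ 2 ≤ 2 * ‖(ψ - P) x‖ ^ 2 + 2 * ‖P x‖ ^ 2 := by
        have e : ψ x = (ψ - P) x + P x := by simp
        calc ‖ψ x‖ ^ 2 = ‖(ψ - P) x + P x‖ ^ 2 := by rw [← e]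
          _ ≤ (‖(ψ - P) x‖ + ‖P x‖) ^ 2 := pow_le_pow_left₀ (norm_nonneg _) (norm_add_le _ _) 2
          _ ≤ 2 * ‖(ψ - P) x‖ ^ 2 + 2 * ‖P x‖ ^ 2 := by nlinarith [sq_nonneg (‖(ψ - P) x‖ - ‖P x‖)]
      have h0 : 0 ≤ 2 * ‖(ψ - P) x‖ ^ 2 := by positivity
      by_cases hi : lidx L M k m layer hlay x = i
      · rw [if_pos hi, if_pos hi]; exact hx
      · rw [if_neg hi, if_neg hi, add_zero]; exact h0
    have h2 := Finset.sum_le_sum fun x (_ : x ∈ Finset.univ) => h1 x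
    rw [Finset.sum_add_distrib, ← Finset.mul_sum] at h2
    have h3 : ∑ x, ‖(ψ - P) x‖ ^ 2 ≤ 4 * d * D := nsq_sub_PiSc_le (fine (lev L k) M) (sGW L k i) (sGW_dvd L M k i) (lev L k) (sGW_le L k i) ψ
    have h4 : ∑ x, (if lidx L M k m layer hlay x = i then 2 * ‖P x‖ ^ 2 else 0)
        = 2 * ∑ z : Anc (fine (lev L k) M) (sGW L k i),
            (if layer (blockOf (lev L k) M z.1) = i then ((sGW L k i : ℕ) : ℝ) ^ d * ‖(meanS (fine (lev L k) M) (sGW L k i) *ᵥ ψ) z‖ ^ 2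
             else 0) := by
      rw [← sum_layer_PiSc_sq L M k m layer hlay i ψ, Finset.mul_sum]
      refine Finset.sum_congr rfl fun x _ => ?_
      split_ifs
      · rw [hP]
      · simp
    have h5 : ∑ z : Anc (fine (lev L k) M) (sGW L k i),
        (if layer (blockOf (lev L k) M z.1) = i then ((sGW L k i : ℕ) : ℝ) ^ d * ‖(meanS (fine (lev L k) M) (sGW L k i) *ᵥ ψ) z‖ ^ 2 else 0)
        ≤ ∑ z : Anc (fine (lev L k) M) (sGW L k i),
          (if layer (blockOf (lev L k) M z.1) = i then wGW L k d i ^ 2 * ‖(meanS (fine (lev L k) M) (sGW L k i) *ᵥ ψ) z‖ ^ 2 else 0) := by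
      refine Finset.sum_le_sum fun z _ => ?_
      split_ifs
      · refine mul_le_mul_of_nonneg_right ?_ (sq_nonneg _)
        rw [wGW_sq]
        have hLi : (1 : ℝ) ≤ (L : ℝ) ^ (2 * (i : ℕ)) := one_le_pow₀ hL1
        have hs0 : (0 : ℝ) ≤ ((sGW L k i : ℕ) : ℝ) ^ d := pow_nonneg (Nat.cast_nonneg _) _
        nlinarith
      · exact le_rfl
    linarith
  -- sum over layers
  have hsum := Finset.sum_le_sum fun i (_ : i ∈ (Finset.univ : Finset (Fin (m + 1)))) => key i
  rw [← sum_sites_by_layer L M k m layer hlay (fun x => ‖ψ x‖ ^ 2), Finset.sum_add_distrib, Finset.sum_const, Finset.card_univ,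
    Fintype.card_fin, nsmul_eq_mul, ← Finset.mul_sum, ← nsq_QsGWw_eq] at hsum
  unfold nsq at hsum ⊢
  push_cast at hsum
  linarith

/-- the LEVEL-FREE coercivity constant of `Δ′_GW`: `min(1/(8d(m+1)+1), a′/2)`. [folklore] -/
def gamGW (d m : ℕ) (a' : ℝ) : ℝ := min (1 / (8 * d * (m + 1) + 1)) (a' / 2)

omit hM in
/-- `0 < gamGW` for `0 < a′`. [folklore] -/
theorem gamGW_pos (ha' : 0 < a') : 0 < gamGW d m a' := by
  unfold gamGW
  refine lt_min ?_ (by linarith)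
  positivity

/-- **SOCKET (GW-S0): `Δ′_GW` IS COERCIVE, LEVEL-FREE** (`layer ≤ m`, `0 < a′`). [cite: Balaban1985BackgroundPropagators, (3.24) p.394 (shape: positivity of Δ′_a)] [folklore] -/
theorem coercive_DpGW (hlay : ∀ y, layer y ≤ m) (ha' : 0 < a') : Coercive (DpGW L M k m layer a') (gamGW d m a') := by
  intro ψ
  rw [form_DpGW]
  set D : ℝ := ∑ ν, nsq (sdiff (fine (lev L k) M) ((lev L k : ℕ) : ℂ) ν *ᵥ ψ) with hD
  set Q : ℝ := nsq (QsGWw L M k m layer *ᵥ ψ) with hQ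
  have hD0 : 0 ≤ D := Finset.sum_nonneg fun ν _ => nsq_nonneg _
  have hQ0 : 0 ≤ Q := nsq_nonneg _
  have h := nsq_le_graded L M k m layer hlay ψ
  have hγ1 : gamGW d m a' ≤ 1 / (8 * d * (m + 1) + 1) := min_le_left _ _
  have hγ2 : gamGW d m a' ≤ a' / 2 := min_le_right _ _
  have hγ0 : 0 ≤ gamGW d m a' := (gamGW_pos (d := d) (m := m) a' ha').le
  have hc : (0 : ℝ) < 8 * d * (m + 1) + 1 := by positivity
  have h1 : gamGW d m a' * (8 * d * (m + 1)) ≤ 1 := by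
    calc gamGW d m a' * (8 * d * (m + 1)) ≤ (1 / (8 * d * (m + 1) + 1)) * (8 * d * (m + 1)) :=
          mul_le_mul_of_nonneg_right hγ1 (by positivity)
      _ ≤ 1 := by rw [div_mul_eq_mul_div, one_mul, div_le_one hc]; linarith
  calc gamGW d m a' * nsq ψ ≤ gamGW d m a' * (8 * d * (m + 1) * D + 2 * Q) := mul_le_mul_of_nonneg_left h hγ0
    _ = (gamGW d m a' * (8 * d * (m + 1))) * D + (2 * gamGW d m a') * Q := by ring
    _ ≤ 1 * D + a' * Q := add_le_add (mul_le_mul_of_nonneg_right h1 hD0) (mul_le_mul_of_nonneg_right (by linarith) hQ0)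
    _ = D + a' * Q := by ring

/-- hence `Δ′_GW` is invertible … [folklore] -/
theorem isUnit_det_DpGW (hlay : ∀ y, layer y ≤ m) (ha' : 0 < a') : IsUnit (DpGW L M k m layer a').det :=
  isUnit_det_of_coercive (gamGW_pos (d := d) (m := m) a' ha') (coercive_DpGW L M k m layer a' hlay ha')

/-- **… with `‖G′_GW‖ ≤ gamGW⁻¹`, LEVEL-FREE**. [cite: Balaban1985BackgroundPropagators, (3.25) p.394 (shape: G′)] [folklore] -/
theorem opNorm_GOmGW_le (hlay : ∀ y, layer y ≤ m) (ha' : 0 < a') : ‖GOmGW L M k m layer a'‖ ≤ (gamGW d m a')⁻¹ :=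
  opNorm_inv_le_of_coercive (gamGW_pos (d := d) (m := m) a' ha') (coercive_DpGW L M k m layer a' hlay ha')

/-- `0 < ‖Δ′_GW‖` (a coercive operator on a nonempty space). [folklore] -/
theorem opNorm_DpGW_pos (hlay : ∀ y, layer y ≤ m) (ha' : 0 < a') : 0 < ‖DpGW L M k m layer a'‖ := by
  set v : TorK L M k → ℂ := fun _ => 1 with hv
  have hγ := gamGW_pos (d := d) (m := m) a' ha'
  have hnsq : 0 < nsq v := by
    unfold nsq
    refine Finset.sum_pos (fun x _ => by simp [hv]) ⟨0, Finset.mem_univ _⟩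
  have h1 := coercive_DpGW L M k m layer a' hlay ha' v
  have hH := DpGW_isHermitian L M k m layer a'
  have e : star (DpGW L M k m layer a' *ᵥ v) ⬝ᵥ v = star v ⬝ᵥ (DpGW L M k m layer a' *ᵥ v) := by
    rw [Matrix.star_mulVec, hH.eq, ← Matrix.dotProduct_mulVec]
  have h2 : (star v ⬝ᵥ (DpGW L M k m layer a' *ᵥ v)).re ≤ ‖DpGW L M k m layer a'‖ * nsq v := by
    rw [← e]; exact RegionGaugeSlice.re_form_le_opNorm _ v
  by_contra h
  push Not at h
  have h3 : ‖DpGW L M k m layer a'‖ = 0 := le_antisymm h (norm_nonneg _)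
  rw [h3, zero_mul] at h2
  nlinarith

end Summit.QuantumFields.BalabanUV.T4Continuum.GradedWellScalarCoercive

end
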